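import Summits.RiemannHypothesis.RiemannHypothesis.Theorems.MotivicDoorAWSInfiniteRank
import Summits.RiemannHypothesis.RiemannHypothesis.Theorems.MotivicDoor.AWS.CanonicalCarrierForm

/-!
# AWS axiom system — integrality is free: the auxiliary bump family (analytic part)

HONEST LABEL (verbatim on every AWS file).  One-way implication from a strengthened,
prime-side-only axiom system; the existence of such an object is NOT claimed and is the located
gap; the converse (RH ⇒ existence) is out of scope and, for this axiom system, tautological
rather than informative (AXIOM-CONTENT.md §2; `riemannHypothesis_iff_exists_tautologicalCarrier`).
Framing: lottery ticket at the motivic door; RH probability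
negligible; consolation prizes are real: a new semi-local Weil-positivity theorem, or a located gap
in the Connes–Consani programme, plus the ff-door theorem.

## Content (RH-free analysis; inputs: the tree's window lower bound and bump toolkit)

The concrete inputs for the greedy integrality construction (`MotivicDoorAWSIntegralGreedy`,
`MotivicDoorAWSIntegralCarrier`), stated for an ARBITRARY generating family `G` that contains a
copy `j ↦ G.φ (e j)` of an auxiliary family `β` of pairwise disjoint bumps in a small window:

* `IntegralAux.exists_posWindow` — a window `[-a, a]`, `0 < a ≤ 1`, on which
  `Re Q(g) ≥ ‖g‖₂²` for test functions supported there (`exists_log_window_lower_bound`).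
* `IntegralAux.exists_auxFamily` — for `a > 0`, bumps `β (n, b)` centred at `± a/2^(n+1)` with
  radius `a/2^(n+3)`: Weil tests, nonnegative, pairwise disjointly supported in `[-a, a]`, the
  `b = true` ones living in `t > 0` and the `b = false` ones in `t < 0`.
* `IntegralAux.Wc_pos_of_supported` — `Re Q > 0` on nonzero real coefficient vectors supported on
  the copy of `β` (so the polarised form `G.Wc` is positive definite there).
* `IntegralAux.exists_fresh_single` — such coefficient vectors are not spanned by any finite set.
* `IntegralAux.masses_surjective` — the two masses `(G.M₀, G.M₁)` map these vectors ONTO `ℝ²`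
  (a bump in `t > 0` and one in `t < 0`: `∫ u (e^{t/2} - e^{-t/2}) dt` has opposite signs).
-/

noncomputable section

open Complex Set MeasureTheory Filter Literature.NumberTheory.LFunctions
open Literature.NumberTheory.ConnesConsani2019
open scoped BigOperators ComplexConjugate ContDiff

namespace Summit.RiemannHypothesis.RiemannHypothesis.Theorems.MotivicDoor.AWS

-- the mandated namespace repeats a component (single-conjunct summit)
set_option linter.dupNamespace false

namespace IntegralAux

/-! ## §1 The positivity window -/

/-- A window `[-a, a]`, `0 < a ≤ 1`, on which Weil's quadratic functional dominates the `L²` norm: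
`‖g‖₂² ≤ Re Q(g)` for every test function `g ≢ 0` supported in the window. -/
theorem exists_posWindow : ∃ a : ℝ, 0 < a ∧ a ≤ 1 ∧ ∀ g : ℝ → ℂ, IsWeilTest g →
    tsupport g ⊆ Icc (-a) a → 0 < ∫ t, ‖g t‖ ^ 2 → ∫ t, ‖g t‖ ^ 2 ≤ (weilQuadratic g).re := by
  obtain ⟨K, a₀, ha₀, ha₀1, hwin⟩ := ConnesConsani.exists_log_window_lower_bound
  refine ⟨min a₀ (Real.exp (-(K + 1))), lt_min ha₀ (Real.exp_pos _),
    (min_le_left _ _).trans ha₀1, fun g hg hs hp ↦ ?_⟩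
  have hloga : 1 ≤ Real.log (1 / min a₀ (Real.exp (-(K + 1)))) - K := by
    have h1 : Real.log (min a₀ (Real.exp (-(K + 1)))) ≤ -(K + 1) := by
      have := Real.log_le_log (lt_min ha₀ (Real.exp_pos _))
        (min_le_right a₀ (Real.exp (-(K + 1))))
      rwa [Real.log_exp] at this
    rw [one_div, Real.log_inv]
    linarith
  exact (le_mul_of_one_le_left hp.le hloga).trans
    (hwin _ (lt_min ha₀ (Real.exp_pos _)) (min_le_left _ _) g hg hs hp)

/-! ## §2 The auxiliary bump family -/

/-- **The auxiliary bumps.**  For `a > 0`: a family `β : ℕ × Bool → ℝ → ℝ` of nonnegative smooth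
bumps, `β (n, b)` centred at `± a / 2^(n+1)` (sign `b`) with radius `a / 2^(n+3)`: Weil test
functions supported in `[-a, a]`, pairwise disjointly supported, each nonzero somewhere, with
`β (n, true)` living in `t > 0` and `β (n, false)` in `t < 0`. -/
theorem exists_auxFamily {a : ℝ} (ha : 0 < a) : ∃ β : ℕ × Bool → ℝ → ℝ,
    (∀ j, IsWeilTest fun t ↦ ((β j t : ℝ) : ℂ)) ∧
    (∀ j, tsupport (β j) ⊆ Icc (-a) a) ∧
    (∀ j k t, j ≠ k → β j t ≠ 0 → β k t = 0) ∧
    (∀ j, ∃ t, β j t ≠ 0) ∧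
    (∀ j t, 0 ≤ β j t) ∧
    (∀ n t, β (n, true) t ≠ 0 → 0 < t) ∧
    (∀ n t, β (n, false) t ≠ 0 → t < 0) := by
  -- centres and radii
  set c : ℕ × Bool → ℝ := fun j ↦ (if j.2 then 1 else -1) * (a / 2 ^ (j.1 + 1)) with hc
  set r : ℕ × Bool → ℝ := fun j ↦ a / 2 ^ (j.1 + 3) with hr
  have hr0 : ∀ j, 0 < r j := fun j ↦ by positivity
  have hct : ∀ k, c (k, true) = a / 2 ^ (k + 1) := fun k ↦ by simp [hc]
  have hcf : ∀ k, c (k, false) = -(a / 2 ^ (k + 1)) := fun k ↦ by simp [hc]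
  have habs : ∀ j, |c j| = a / 2 ^ (j.1 + 1) := fun j ↦ by
    rcases j with ⟨n, _ | _⟩
    · rw [hcf, abs_neg, abs_of_pos (by positivity)]
    · rw [hct, abs_of_pos (by positivity)]
  have hmono : ∀ m n : ℕ, m ≤ n → a / 2 ^ n ≤ a / 2 ^ m := fun m n hmn ↦
    div_le_div_of_nonneg_left ha.le (by positivity) (pow_le_pow_right₀ (by norm_num) hmn)
  -- the bumps
  let b : (j : ℕ × Bool) → ContDiffBump (c j) := fun j ↦
    ⟨r j / 2, r j, by have := hr0 j; positivity, by have := hr0 j; linarith⟩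
  have hball : ∀ j t, (b j) t ≠ 0 → |t - c j| < r j := fun j t h ↦ by
    have ht : t ∈ Function.support (b j) := h
    rw [(b j).support_eq, Metric.mem_ball, Real.dist_eq] at ht
    exact ht
  -- separation of the centres
  have hsep : ∀ j k, j ≠ k → r j + r k ≤ |c j - c k| := by
    rintro ⟨m, bm⟩ ⟨n, bn⟩ hjk
    by_cases hb : bm = bn
    · subst hb
      have hmn : m ≠ n := fun h ↦ hjk (by rw [h])
      -- same side: WLOG `m < n`
      wlog hlt : m < n generalizing m n
      · have := this n m (fun h ↦ hjk (by rw [h])) hmn.symm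
          (lt_of_le_of_ne (not_lt.mp hlt) hmn.symm)
        rwa [add_comm, abs_sub_comm] at this
      have h1 : a / 2 ^ (n + 1) ≤ a / 2 ^ (m + 1) / 2 := by
        rw [show a / 2 ^ (m + 1) / 2 = a / 2 ^ (m + 2) by ring]; exact hmono _ _ (by omega)
      have h2 : a / 2 ^ (n + 3) ≤ a / 2 ^ (m + 3) := hmono _ _ (by omega)
      have h3 : a / 2 ^ (m + 3) = a / 2 ^ (m + 1) / 4 := by ring
      have hx : 0 < a / 2 ^ (m + 1) := by positivity
      have hcdiff : c (m, bm) - c (n, bm) =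
          (if bm then 1 else -1) * (a / 2 ^ (m + 1) - a / 2 ^ (n + 1)) := by
        simp only [hc]; ring
      rw [hcdiff, abs_mul]
      have hsgn : |(if bm then (1 : ℝ) else -1)| = 1 := by split_ifs <;> simp
      rw [hsgn, one_mul, abs_of_nonneg (by linarith)]
      simp only [hr]
      linarith
    · -- opposite sides
      have hpm : 0 < a / 2 ^ (m + 1) := by positivity
      have hpn : 0 < a / 2 ^ (n + 1) := by positivity
      have hcdiff : |c (m, bm) - c (n, bn)| = a / 2 ^ (m + 1) + a / 2 ^ (n + 1) := by
        rcases bm with _ | _ <;> rcases bn with _ | _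
        · exact absurd rfl hb
        · rw [hcf, hct, show -(a / 2 ^ (m + 1)) - a / 2 ^ (n + 1)
            = -(a / 2 ^ (m + 1) + a / 2 ^ (n + 1)) by ring, abs_neg, abs_of_pos (by positivity)]
        · rw [hct, hcf, sub_neg_eq_add, abs_of_pos (by positivity)]
        · exact absurd rfl hb
      rw [hcdiff]
      simp only [hr]
      linarith [hmono (m + 1) (m + 3) (by omega), hmono (n + 1) (n + 3) (by omega)]
  refine ⟨fun j ↦ b j, fun j ↦ isWeilTest_contDiffBump (b j), fun j ↦ ?_, fun j k t hjk h ↦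
    contDiffBump_eq_zero_of_ne_zero (b j) (b k) (hsep j k hjk) h, fun j ↦ ⟨c j, ?_⟩,
    fun j t ↦ (b j).nonneg, fun n t h ↦ ?_, fun n t h ↦ ?_⟩
  · -- support in the window
    rw [(b j).tsupport_eq]
    intro t ht
    rw [Metric.mem_closedBall, Real.dist_eq] at ht
    change |t - c j| ≤ r j at ht
    have h1 : |c j| ≤ a / 2 := by rw [habs]; simpa using hmono 1 (j.1 + 1) (by omega)
    have h2 : r j ≤ a / 2 := by
      change a / 2 ^ (j.1 + 3) ≤ a / 2; simpa using hmono 1 (j.1 + 3) (by omega)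
    have ht' : |t| ≤ a :=
      calc |t| = |t - c j + c j| := by rw [sub_add_cancel]
        _ ≤ |t - c j| + |c j| := abs_add_le _ _
        _ ≤ a / 2 + a / 2 := add_le_add (ht.trans h2) h1
        _ = a := by ring
    exact mem_Icc.mpr (abs_le.mp ht')
  · -- nonzero at the centre (`β j (c j) = 1`)
    change (b j) (c j) ≠ 0
    rw [(b j).one_of_mem_closedBall (Metric.mem_closedBall_self (b j).rIn_pos.le)]
    exact one_ne_zero
  · -- `β (n, true)` lives in `t > 0`
    have h1 := hball (n, true) t h
    rw [hct] at h1
    change |t - a / 2 ^ (n + 1)| < a / 2 ^ (n + 3) at h1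
    have h3 : a / 2 ^ (n + 3) = a / 2 ^ (n + 1) / 4 := by ring
    have h4 : 0 < a / 2 ^ (n + 1) := by positivity
    linarith [(abs_lt.mp h1).1]
  · -- `β (n, false)` lives in `t < 0`
    have h1 := hball (n, false) t h
    rw [hcf] at h1
    change |t - -(a / 2 ^ (n + 1))| < a / 2 ^ (n + 3) at h1
    have h3 : a / 2 ^ (n + 3) = a / 2 ^ (n + 1) / 4 := by ring
    have h4 : 0 < a / 2 ^ (n + 1) := by positivity
    linarith [(abs_lt.mp h1).2]

/-! ## §3 Supported coefficient vectors: `Re Q > 0` -/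

/-- `rtest` of a single generator. -/
theorem rtest_single (G : GeneratingFamily) (i : G.ι) (r : ℝ) :
    G.rtest (Finsupp.single i r) = fun t ↦ r * G.φ i t := by
  funext t; simp [GeneratingFamily.rtest, Finsupp.sum_single_index]

/-- `rtest` as a sum over the support. -/
theorem rtest_apply_eq_sum (G : GeneratingFamily) (x : G.ι →₀ ℝ) (t : ℝ) :
    G.rtest x t = ∑ i ∈ x.support, x i * G.φ i t := rfl

/-- `rtest` of a finite sum of coefficient vectors. -/
theorem rtest_finset_sum (G : GeneratingFamily) {κ : Type*} (S : Finset κ) (v : κ → (G.ι →₀ ℝ)) :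
    G.rtest (∑ a ∈ S, v a) = fun t ↦ ∑ a ∈ S, G.rtest (v a) t := by
  classical
  induction S using Finset.induction_on with
  | empty => funext t; simp [GeneratingFamily.rtest]
  | insert a S ha ih =>
    funext t
    rw [Finset.sum_insert ha, G.rtest_add, Pi.add_apply, ih, Finset.sum_insert ha]

/-- **Positive definiteness on the auxiliary block.**  If a generating family `G` contains a copy
`j ↦ G.φ (e j)` of a family `β` of pairwise disjointly supported functions, each nonzero
somewhere and all supported in a window `[-a, a]` on which `‖g‖₂² ≤ Re Q(g)`, then `Re Q`, i.e.
the canonical carrier form `G.Wc x x`, is `> 0` at every nonzero real coefficient vector `x`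
supported on the copy. -/
theorem Wc_pos_of_supported (G : GeneratingFamily) {a : ℝ}
    (hwin : ∀ g : ℝ → ℂ, IsWeilTest g → tsupport g ⊆ Icc (-a) a → 0 < ∫ t, ‖g t‖ ^ 2 →
      ∫ t, ‖g t‖ ^ 2 ≤ (weilQuadratic g).re)
    {J : Type*} (e : J → G.ι) (β : J → ℝ → ℝ) (hφ : ∀ j, G.φ (e j) = β j)
    (hsupp : ∀ j, tsupport (β j) ⊆ Icc (-a) a) (hdisj : ∀ j k t, j ≠ k → β j t ≠ 0 → β k t = 0)
    (hne : ∀ j, ∃ t, β j t ≠ 0) (x : G.ι →₀ ℝ) (hx : x ∈ Finsupp.supported ℝ ℝ (Set.range e))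
    (hx0 : x ≠ 0) : 0 < G.Wc x x := by
  have hW := G.isWeilTest_rtest x
  have hidx : ∀ i ∈ x.support, ∃ j, e j = i := fun i hi ↦
    (Finsupp.mem_supported ℝ x).mp hx (Finset.mem_coe.mpr hi)
  -- the support of `rtest x` lies in the window
  have hts : tsupport (fun t ↦ (G.rtest x t : ℂ)) ⊆ Icc (-a) a := by
    refine tsupport_ofReal_subset isClosed_Icc fun t ht ↦ ?_
    rw [rtest_apply_eq_sum]
    refine Finset.sum_eq_zero fun i hi ↦ ?_
    obtain ⟨j, rfl⟩ := hidx i hi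
    rw [hφ, image_eq_zero_of_notMem_tsupport (fun h ↦ ht (hsupp j h)), mul_zero]
  -- `rtest x` does not vanish identically
  obtain ⟨i₀, hi₀⟩ := Finsupp.support_nonempty_iff.mpr hx0
  obtain ⟨j₀, hj₀⟩ := hidx i₀ hi₀
  obtain ⟨t₀, ht₀⟩ := hne j₀
  have hval : G.rtest x t₀ = x i₀ * β j₀ t₀ := by
    rw [rtest_apply_eq_sum, Finset.sum_eq_single i₀]
    · rw [← hj₀, hφ]
    · intro i hi hne'
      obtain ⟨j, rfl⟩ := hidx i hi
      rw [hφ, hdisj j₀ j t₀ (fun h ↦ hne' (by rw [← h, hj₀])) ht₀, mul_zero]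
    · intro h; exact absurd hi₀ h
  have hne0 : G.rtest x t₀ ≠ 0 := by
    rw [hval]; exact mul_ne_zero (Finsupp.mem_support_iff.mp hi₀) ht₀
  -- hence `0 < ∫ ‖g‖² ≤ Re Q(g)`
  have hpos : 0 < ∫ t, ‖(G.rtest x t : ℂ)‖ ^ 2 := by
    have hcont : Continuous (G.rtest x) := (contDiff_of_isWeilTest_ofReal hW).continuous
    have hcs : HasCompactSupport (G.rtest x) := hasCompactSupport_of_isWeilTest hW
    have h1 : (fun t ↦ ‖(G.rtest x t : ℂ)‖ ^ 2) = fun t ↦ G.rtest x t * G.rtest x t := by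
      funext t; rw [Complex.norm_real, Real.norm_eq_abs, sq_abs, sq]
    rw [h1]
    exact (hcont.mul hcont).integral_pos_of_hasCompactSupport_nonneg_nonzero hcs.mul_left
      (fun t ↦ mul_self_nonneg _) (mul_ne_zero hne0 hne0)
  rw [G.Wc_self]
  exact hpos.trans_le (hwin _ hW hts hpos)

/-! ## §4 The auxiliary block is infinite-dimensional -/

/-- **Fresh directions.**  For an infinite index type `J` and an injection `e : J → ι`, no finite
set of coefficient vectors spans all vectors supported on `range e`. -/
theorem exists_fresh_single {ι J : Type*} [Infinite J] (e : J → ι) (he : Function.Injective e)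
    (s : Finset (ι →₀ ℝ)) :
    ∃ w ∈ Finsupp.supported ℝ ℝ (Set.range e), w ∉ Submodule.span ℝ (s : Set (ι →₀ ℝ)) := by
  classical
  set T : Finset ι := s.biUnion Finsupp.support with hT
  obtain ⟨j₀, hj₀⟩ := Infinite.exists_notMem_finset (T.preimage e he.injOn)
  refine ⟨Finsupp.single (e j₀) 1, Finsupp.single_mem_supported ℝ 1 (Set.mem_range_self j₀),
    fun hmem ↦ ?_⟩
  have hle : Submodule.span ℝ (s : Set (ι →₀ ℝ)) ≤ Finsupp.supported ℝ ℝ (T : Set ι) :=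
    Submodule.span_le.mpr fun v hv ↦ (Finsupp.mem_supported ℝ v).mpr fun i hi ↦
      Finset.mem_coe.mpr (Finset.mem_biUnion.mpr ⟨v, Finset.mem_coe.mp hv, Finset.mem_coe.mp hi⟩)
  have h1 := (Finsupp.mem_supported ℝ _).mp (hle hmem)
  have h2 : e j₀ ∈ T := Finset.mem_coe.mp (h1 (Finset.mem_coe.mpr
    (Finsupp.mem_support_iff.mpr (by simp))))
  exact hj₀ (Finset.mem_preimage.mpr h2)

/-! ## §5 The two masses are jointly onto `ℝ²` on the auxiliary block -/

/-- Real part of the Mellin transform of a real function on the real axis. -/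
theorem re_weilMellin_ofReal (g : ℝ → ℝ) (σ : ℝ) :
    (weilMellin (fun t ↦ (g t : ℂ)) σ).re = ∫ t, g t * Real.exp ((σ - 1 / 2) * t) := by
  unfold weilMellin
  have : (fun t : ℝ ↦ (g t : ℂ) * cexp (((σ : ℂ) - 1 / 2) * t)) =
      fun t ↦ ((g t * Real.exp ((σ - 1 / 2) * t) : ℝ) : ℂ) := by
    funext t; push_cast; ring_nf
  rw [this, integral_complex_ofReal, Complex.ofReal_re]

/-- A positivity template: `∫ u·w > 0` when `u` is continuous with compact support, not
identically zero, and `u·w > 0` wherever `u ≠ 0`. -/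
theorem integral_mul_pos {u w : ℝ → ℝ} (hu : Continuous u) (hcs : HasCompactSupport u)
    (hw : Continuous w) (hsign : ∀ t, u t ≠ 0 → 0 < u t * w t) {t₀ : ℝ} (ht₀ : u t₀ ≠ 0) :
    0 < ∫ t, u t * w t :=
  (hu.mul hw).integral_pos_of_hasCompactSupport_nonneg_nonzero hcs.mul_right
    (fun t ↦ by
      by_cases h : u t = 0
      · simp [h]
      · exact (hsign t h).le)
    (hsign t₀ ht₀).ne'

/-- **Masses onto `ℝ²`.**  If `G` contains a copy of a family `β` of nonnegative Weil test
functions each nonzero somewhere, one member `β jp` living in `t > 0` and one `β jm` in `t < 0`,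
then `(G.M₀, G.M₁) = (∫ · d*u, ∫ · du)` maps the coefficient vectors supported on the copy onto
`ℝ²`: the `2 × 2` mass matrix of `β jp, β jm` has determinant `< 0`, because
`∫ β (e^{t/2} - e^{-t/2}) dt` is `> 0` for `β jp` and `< 0` for `β jm`. -/
theorem masses_surjective (G : GeneratingFamily) {J : Type*} (e : J → G.ι) (β : J → ℝ → ℝ)
    (hφ : ∀ j, G.φ (e j) = β j) (hW : ∀ j, IsWeilTest fun t ↦ (β j t : ℂ))
    (hnn : ∀ j t, 0 ≤ β j t) (hne : ∀ j, ∃ t, β j t ≠ 0) (jp jm : J)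
    (hplus : ∀ t, β jp t ≠ 0 → 0 < t) (hminus : ∀ t, β jm t ≠ 0 → t < 0) (y : Fin 2 → ℝ) :
    ∃ x ∈ Finsupp.supported ℝ ℝ (Set.range e), ∀ i, (![G.M₀, G.M₁] i) x = y i := by
  -- the four masses
  set m₀ : J → ℝ := fun j ↦ ∫ t, β j t * Real.exp ((0 - 1 / 2) * t) with hm₀
  set m₁ : J → ℝ := fun j ↦ ∫ t, β j t * Real.exp ((1 - 1 / 2) * t) with hm₁
  have hM₀ : ∀ j, G.M₀ (Finsupp.single (e j) 1) = m₀ j := fun j ↦ by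
    change (weilMellin (fun t ↦ (G.rtest (Finsupp.single (e j) 1) t : ℂ)) 0).re = _
    rw [rtest_single, hφ]; simp only [one_mul]
    exact_mod_cast re_weilMellin_ofReal (β j) 0
  have hM₁ : ∀ j, G.M₁ (Finsupp.single (e j) 1) = m₁ j := fun j ↦ by
    change (weilMellin (fun t ↦ (G.rtest (Finsupp.single (e j) 1) t : ℂ)) 1).re = _
    rw [rtest_single, hφ]; simp only [one_mul]
    exact_mod_cast re_weilMellin_ofReal (β j) 1
  -- sign information
  have hcont : ∀ j, Continuous (β j) := fun j ↦ (contDiff_of_isWeilTest_ofReal (hW j)).continuous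
  have hcs : ∀ j, HasCompactSupport (β j) := fun j ↦ hasCompactSupport_of_isWeilTest (hW j)
  have hβpos : ∀ j t, β j t ≠ 0 → 0 < β j t := fun j t h ↦ lt_of_le_of_ne (hnn j t) (Ne.symm h)
  have hwc : ∀ c : ℝ, Continuous fun t : ℝ ↦ Real.exp ((c - 1 / 2) * t) := fun c ↦
    Real.continuous_exp.comp (continuous_const.mul continuous_id)
  have hint : ∀ j (c : ℝ), Integrable fun t ↦ β j t * Real.exp ((c - 1 / 2) * t) := fun j c ↦
    ((hcont j).mul (hwc c)).integrable_of_hasCompactSupport (hcs j).mul_right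
  have hS : ∀ j, 0 < m₀ j + m₁ j := fun j ↦ by
    obtain ⟨t₀, ht₀⟩ := hne j
    simp only [hm₀, hm₁]
    rw [← integral_add (hint j 0) (hint j 1)]
    simp_rw [← mul_add]
    exact integral_mul_pos (hcont j) (hcs j) ((hwc 0).add (hwc 1))
      (fun t h ↦ mul_pos (hβpos j t h) (by positivity)) ht₀
  have hDp : 0 < m₁ jp - m₀ jp := by
    obtain ⟨t₀, ht₀⟩ := hne jp
    simp only [hm₀, hm₁]
    rw [← integral_sub (hint jp 1) (hint jp 0)]
    simp_rw [← mul_sub]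
    refine integral_mul_pos (hcont jp) (hcs jp) ((hwc 1).sub (hwc 0))
      (fun t h ↦ mul_pos (hβpos jp t h) (sub_pos.mpr (Real.exp_lt_exp.mpr ?_))) ht₀
    have := hplus t h
    linarith
  have hDm : 0 < m₀ jm - m₁ jm := by
    obtain ⟨t₀, ht₀⟩ := hne jm
    simp only [hm₀, hm₁]
    rw [← integral_sub (hint jm 0) (hint jm 1)]
    simp_rw [← mul_sub]
    refine integral_mul_pos (hcont jm) (hcs jm) ((hwc 0).sub (hwc 1))
      (fun t h ↦ mul_pos (hβpos jm t h) (sub_pos.mpr (Real.exp_lt_exp.mpr ?_))) ht₀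
    have := hminus t h
    linarith
  -- the determinant is negative
  set Δ : ℝ := m₀ jp * m₁ jm - m₀ jm * m₁ jp with hΔ
  have hΔneg : Δ < 0 := by
    have h1 := mul_pos (hS jp) hDm
    have h2 := mul_pos (hS jm) hDp
    nlinarith [h1, h2]
  have hΔ0 : Δ ≠ 0 := hΔneg.ne
  -- Cramer
  set α : ℝ := (y 0 * m₁ jm - y 1 * m₀ jm) / Δ with hα
  set γ : ℝ := (m₀ jp * y 1 - m₁ jp * y 0) / Δ with hγ
  refine ⟨α • Finsupp.single (e jp) 1 + γ • Finsupp.single (e jm) 1,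
    Submodule.add_mem _ (Submodule.smul_mem _ _ (Finsupp.single_mem_supported ℝ 1
      (Set.mem_range_self _))) (Submodule.smul_mem _ _ (Finsupp.single_mem_supported ℝ 1
      (Set.mem_range_self _))), Fin.forall_fin_two.mpr ⟨?_, ?_⟩⟩
  · simp only [Matrix.cons_val_zero, map_add, map_smul, smul_eq_mul, hM₀]
    rw [hα, hγ]; field_simp; ring
  · simp only [Matrix.cons_val_one, Matrix.cons_val_zero, map_add, map_smul, smul_eq_mul, hM₁]
    rw [hα, hγ]; field_simp; ring

end IntegralAux

end Summit.RiemannHypothesis.RiemannHypothesis.Theorems.MotivicDoor.AWS
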